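import Summits.CriticalPhenomena.PercolationContinuityZ3.Theorems.PercNearOneGluingNoHeavyLowerTailCubicThreePointSections
import HarnessLib

/-!
# `NoHeavyLowerTail` (stmt-CriticalPhenomena-4575) — apex-refined three-point cells: the events `N`, `M`, `N′`, `W`, their sections and support monotonicity

Support file (prover prim-ineq-gen-2 gen 3, new-inequality factory; `--supports stmt-CriticalPhenomena-4575`).  Finitary weighted-cube
calculus of `…CubicThreePointSections` (prim-ineq-prove-2): configurations `S ⊆ D` of open random edges, forced edges `K`, open graph
`fromEdgeSet (S ∪ K)`, reachability `R K S x y`, masses `PrW D p`.  No named facts, no sorries.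

This part refines the two extreme cells of the three-point partition of the terminals `a, b, c` (apex `a`) as in the memo
run/shared/lean/prim/prim-ineq-gen-2/HMAX-SPLIT.md and `…CubicThreePointApexSplit/ApexStep`:
* `Rdel K S a x y` — reachability in the open graph with every edge at `a` removed ("`x ~ y` in `ω ∖ a`");
* `evN K a b c` (`abc` and `b ≁ c` in `ω ∖ a`: the apex is an open cut vertex between `b` and `c`), `evM` (`abc` and `b ~ c` in `ω ∖ a`),
  so that `evT = evN ⊔ evM` (`ind_evT`, `PrW_evT`);
* `Sep E K S a b c` — every `b–c` path of the SUPPORT graph `E` meets the open cluster of `a`; `evNp E K a b c` (`a|b|c` and separating),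
  `evW E K a b c` (`a|b|c`, not separating), `evQ = evNp ⊔ evW` (`ind_evQ`, `PrW_evQ`);
* the `{e} ∪ ·`-SECTIONS of the refined cells of `K` are the refined cells of `K ∪ {e}` with the SAME support (`sect_evN`, `sect_evM`, `sect_evNp`,
  `sect_evW`) — so conditioning on one more open edge is again a forced-edge law, exactly as for the five plain cells;
* SUPPORT MONOTONICITY (`evNp_anti`, `PrW_evNp_anti`): enlarging the support can only destroy separation, `E ⊆ E′ ⇒ PrW(evNp E′) ≤ PrW(evNp E)` —
  the inequality that lets the edge-deleted minor (smaller support) serve as induction hypothesis for the closed section.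
Part 2 (`…CubicThreePointApexInduction`) runs the `|D|`-induction for the row `Γ` along edges at `b`, modulo the census-validated step hypothesis.
[cite: GladkovZimin2024HK, §4 (one-coordinate decomposition / forced edges)]
-/

noncomputable section

namespace Summit.CriticalPhenomena.PercolationContinuityZ3.Theorems

namespace CubicThreePointApex

open Finset SimpleGraph Literature.Probability.Percolation.DecisionTree CubicThreePointStep

variable {V : Type*} [DecidableEq V]

/-! ### Reachability avoiding the apex, and the refinement of `abc` -/

/-- `Rdel K S a x y`: `x` and `y` are joined by a path of open-or-forced edges none of which contains `a`. [folklore] -/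
def Rdel (K S : Finset (Sym2 V)) (a x y : V) : Prop :=
  (fromEdgeSet {f : Sym2 V | f ∈ S ∪ K ∧ a ∉ f}).Reachable x y

/-- Forcing `e` is the same as opening it, for `Rdel`. [folklore] -/
theorem Rdel_insert_config_iff (K S : Finset (Sym2 V)) (e : Sym2 V) (a x y : V) :
    Rdel K (insert e S) a x y ↔ Rdel (insert e K) S a x y := by
  unfold Rdel
  rw [Finset.insert_union, Finset.union_insert]

variable (K : Finset (Sym2 V)) (a b c : V)

/-- `N`: `abc` with the apex an open cut vertex between `b` and `c` (`b ≁ c` in `ω ∖ a`). [folklore] -/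
def evN : Set (Finset (Sym2 V)) := {S | R K S a b ∧ R K S a c ∧ ¬ Rdel K S a b c}
/-- `M`: `abc` with `b ~ c` in `ω ∖ a`. [folklore] -/
def evM : Set (Finset (Sym2 V)) := {S | R K S a b ∧ R K S a c ∧ Rdel K S a b c}

variable {K a b c}

/-- Membership in `evN`. [folklore] -/
@[simp] theorem mem_evN {S} : S ∈ evN K a b c ↔ R K S a b ∧ R K S a c ∧ ¬ Rdel K S a b c := Iff.rfl
/-- Membership in `evM`. [folklore] -/
@[simp] theorem mem_evM {S} : S ∈ evM K a b c ↔ R K S a b ∧ R K S a c ∧ Rdel K S a b c := Iff.rfl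

/-- `1[abc] = 1[N] + 1[M]` pointwise. [folklore] -/
theorem ind_evT (K : Finset (Sym2 V)) (a b c : V) (S : Finset (Sym2 V)) :
    ind (evT K a b c) S = ind (evN K a b c) S + ind (evM K a b c) S := by
  by_cases hT : S ∈ evT K a b c
  · rw [mem_evT] at hT
    by_cases hd : Rdel K S a b c
    · rw [ind_of_mem (show S ∈ evT K a b c from hT), ind_of_not_mem (show S ∉ evN K a b c from fun h => h.2.2 hd),
        ind_of_mem (show S ∈ evM K a b c from ⟨hT.1, hT.2, hd⟩)]; ring
    · rw [ind_of_mem (show S ∈ evT K a b c from hT), ind_of_mem (show S ∈ evN K a b c from ⟨hT.1, hT.2, hd⟩),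
        ind_of_not_mem (show S ∉ evM K a b c from fun h => hd h.2.2)]; ring
  · rw [ind_of_not_mem hT, ind_of_not_mem (show S ∉ evN K a b c from fun h => hT ⟨h.1, h.2.1⟩),
      ind_of_not_mem (show S ∉ evM K a b c from fun h => hT ⟨h.1, h.2.1⟩)]; ring

/-- `t = n + m` for the weighted masses. [folklore] -/
theorem PrW_evT (D : Finset (Sym2 V)) (p : Sym2 V → ℝ) (K : Finset (Sym2 V)) (a b c : V) :
    PrW D p (evT K a b c) = PrW D p (evN K a b c) + PrW D p (evM K a b c) :=
  PrW_of_ind_add D p fun S _ => ind_evT K a b c S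

/-! ### Separation of `b` from `c` by the open cluster of the apex, in the support graph -/

/-- `Sep E K S a b c`: in the support graph `E`, every `b–c` path meets the open cluster `{z | R K S a z}` of `a`
(no `b–c` path among the support edges avoiding that cluster). [folklore] -/
def Sep (E K S : Finset (Sym2 V)) (a b c : V) : Prop :=
  ¬ (fromEdgeSet {f : Sym2 V | f ∈ E ∧ ∀ z, z ∈ f → ¬ R K S a z}).Reachable b c

/-- Forcing `e` is the same as opening it, for `Sep` (the support is unchanged). [folklore] -/
theorem Sep_insert_config_iff (E K S : Finset (Sym2 V)) (e : Sym2 V) (a b c : V) :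
    Sep E K (insert e S) a b c ↔ Sep E (insert e K) S a b c := by
  unfold Sep
  simp only [R_insert_config_iff]

/-- Enlarging the support can only destroy separation. [folklore] -/
theorem Sep_anti {E E' K S : Finset (Sym2 V)} (hE : E ⊆ E') {a b c : V} (h : Sep E' K S a b c) : Sep E K S a b c := by
  intro hr
  apply h
  refine hr.mono (fromEdgeSet_mono ?_)
  intro f hf
  exact ⟨hE hf.1, hf.2⟩

variable (E K : Finset (Sym2 V)) (a b c : V)

/-- `N′`: `a|b|c` with the open cluster of the apex separating `b` from `c` in the support. [folklore] -/
def evNp : Set (Finset (Sym2 V)) := {S | (¬ R K S a b ∧ ¬ R K S a c ∧ ¬ R K S b c) ∧ Sep E K S a b c}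
/-- `W`: `a|b|c`, not separating. [folklore] -/
def evW : Set (Finset (Sym2 V)) := {S | (¬ R K S a b ∧ ¬ R K S a c ∧ ¬ R K S b c) ∧ ¬ Sep E K S a b c}

variable {E K a b c}

/-- Membership in `evNp`. [folklore] -/
@[simp] theorem mem_evNp {S} : S ∈ evNp E K a b c ↔ (¬ R K S a b ∧ ¬ R K S a c ∧ ¬ R K S b c) ∧ Sep E K S a b c := Iff.rfl
/-- Membership in `evW`. [folklore] -/
@[simp] theorem mem_evW {S} : S ∈ evW E K a b c ↔ (¬ R K S a b ∧ ¬ R K S a c ∧ ¬ R K S b c) ∧ ¬ Sep E K S a b c := Iff.rfl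

/-- `1[a|b|c] = 1[N′] + 1[W]` pointwise. [folklore] -/
theorem ind_evQ (E K : Finset (Sym2 V)) (a b c : V) (S : Finset (Sym2 V)) :
    ind (evQ K a b c) S = ind (evNp E K a b c) S + ind (evW E K a b c) S := by
  by_cases hQ : S ∈ evQ K a b c
  · rw [mem_evQ] at hQ
    by_cases hs : Sep E K S a b c
    · rw [ind_of_mem (show S ∈ evQ K a b c from hQ), ind_of_mem (show S ∈ evNp E K a b c from ⟨hQ, hs⟩),
        ind_of_not_mem (show S ∉ evW E K a b c from fun h => h.2 hs)]; ring
    · rw [ind_of_mem (show S ∈ evQ K a b c from hQ), ind_of_not_mem (show S ∉ evNp E K a b c from fun h => hs h.2),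
        ind_of_mem (show S ∈ evW E K a b c from ⟨hQ, hs⟩)]; ring
  · rw [ind_of_not_mem hQ, ind_of_not_mem (show S ∉ evNp E K a b c from fun h => hQ h.1),
      ind_of_not_mem (show S ∉ evW E K a b c from fun h => hQ h.1)]; ring

/-- `q = n′ + w` for the weighted masses. [folklore] -/
theorem PrW_evQ (D : Finset (Sym2 V)) (p : Sym2 V → ℝ) (E K : Finset (Sym2 V)) (a b c : V) :
    PrW D p (evQ K a b c) = PrW D p (evNp E K a b c) + PrW D p (evW E K a b c) :=
  PrW_of_ind_add D p fun S _ => ind_evQ E K a b c S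

/-- Support monotonicity of `N′`: `E ⊆ E′ ⇒ evNp E′ ⊆ evNp E`. [folklore] -/
theorem evNp_anti {E E' : Finset (Sym2 V)} (hE : E ⊆ E') (K : Finset (Sym2 V)) (a b c : V) :
    evNp E' K a b c ⊆ evNp E K a b c :=
  fun _ h => ⟨h.1, Sep_anti hE h.2⟩

/-- … hence `PrW(evNp E′) ≤ PrW(evNp E)` for weights in `[0,1]`. [folklore] -/
theorem PrW_evNp_anti (D : Finset (Sym2 V)) {p : Sym2 V → ℝ} (hp0 : ∀ i, 0 ≤ p i) (hp1 : ∀ i, p i ≤ 1)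
    {E E' : Finset (Sym2 V)} (hE : E ⊆ E') (K : Finset (Sym2 V)) (a b c : V) :
    PrW D p (evNp E' K a b c) ≤ PrW D p (evNp E K a b c) :=
  PrW_mono D hp0 hp1 fun _ _ hS => evNp_anti hE K a b c hS

/-! ### Sections: conditioning on one more open edge is forcing it -/

/-- The `{e} ∪ ·`-section of `N` of `K` is `N` of `K ∪ {e}`. [folklore] -/
theorem sect_evN (K : Finset (Sym2 V)) (a b c : V) (e : Sym2 V) :
    {S | insert e S ∈ evN K a b c} = evN (insert e K) a b c := by
  ext S; simp only [Set.mem_setOf_eq, mem_evN, R_insert_config_iff, Rdel_insert_config_iff]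
/-- The `{e} ∪ ·`-section of `M` of `K` is `M` of `K ∪ {e}`. [folklore] -/
theorem sect_evM (K : Finset (Sym2 V)) (a b c : V) (e : Sym2 V) :
    {S | insert e S ∈ evM K a b c} = evM (insert e K) a b c := by
  ext S; simp only [Set.mem_setOf_eq, mem_evM, R_insert_config_iff, Rdel_insert_config_iff]
/-- The `{e} ∪ ·`-section of `N′` of `K` (support `E`) is `N′` of `K ∪ {e}` (same support). [folklore] -/
theorem sect_evNp (E K : Finset (Sym2 V)) (a b c : V) (e : Sym2 V) :
    {S | insert e S ∈ evNp E K a b c} = evNp E (insert e K) a b c := by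
  ext S; simp only [Set.mem_setOf_eq, mem_evNp, R_insert_config_iff, Sep_insert_config_iff]
/-- The `{e} ∪ ·`-section of `W` of `K` (support `E`) is `W` of `K ∪ {e}` (same support). [folklore] -/
theorem sect_evW (E K : Finset (Sym2 V)) (a b c : V) (e : Sym2 V) :
    {S | insert e S ∈ evW E K a b c} = evW E (insert e K) a b c := by
  ext S; simp only [Set.mem_setOf_eq, mem_evW, R_insert_config_iff, Sep_insert_config_iff]

end CubicThreePointApex

end Summit.CriticalPhenomena.PercolationContinuityZ3.Theorems
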